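import Mathlib.AlgebraicGeometry.Morphisms.LocalFlatDescent
import Mathlib.AlgebraicGeometry.Morphisms.FlatDescent
import Mathlib.AlgebraicGeometry.Morphisms.SchemeTheoreticallyDominant
import Mathlib.AlgebraicGeometry.Morphisms.Proper
import Literature.AlgebraicGeometry.Motives.BaseChangeProofs
import HarnessLib

/-!
# Descent of properties of `k`-schemes and `k`-morphisms from their base change to a larger field

For a homomorphism of fields `σ : k →+* L`, the projection `X₀ ⊗_σ L → X₀` is faithfully flat and
quasi-compact (a base change of `Spec L → Spec k`), so fpqc descent (EGA IV₂ 2.7.1; Mathlib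
`MorphismProperty.DescendsAlong (@Surjective ⊓ @Flat ⊓ @QuasiCompact)`) reads properties of a
`k`-morphism `f₀ : X₀ ⟶ Y₀` off its base change `f₀ ⊗_σ L`: locally of finite type, smooth,
universally closed, separated (via "separated = diagonal universally closed", the diagonal being an
immersion), proper; and `X₀` is reduced as soon as `X₀ ⊗_σ L` is (EGA IV₂ 2.1.13: the projection is
scheme-theoretically dominant).
-/

noncomputable section

open CategoryTheory CategoryTheory.Limits AlgebraicGeometry

set_option backward.isDefEq.respectTransparency false

namespace Literature.AlgebraicGeometry.Motives

section Descent

variable {k L : Type} [Field k] [Field L] (σ : k →+* L)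

/-- The projection `X₀ ⊗_σ L → X₀` is surjective, flat and quasi-compact (base change of the
fpqc cover `Spec L → Spec k`). [cite: GrothendieckDieudonne1965, Prop. 2.7.1 (setting)] -/
theorem surjective_flat_quasiCompact_baseChangeHomFst (X₀ : SchemeOver k) :
    (@Surjective ⊓ @Flat ⊓ @QuasiCompact : MorphismProperty Scheme) (baseChangeHomFst σ X₀) := by
  letI := σ.toAlgebra
  haveI : Subsingleton ↥(Spec (CommRingCat.of k)) :=
    inferInstanceAs (Subsingleton (PrimeSpectrum k))
  haveI h1 : Surjective (Spec.map (CommRingCat.ofHom σ)) :=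
    ⟨fun x ↦ ⟨(default : ↥(Spec (CommRingCat.of L))), Subsingleton.elim _ _⟩⟩
  haveI h2 : Flat (Spec.map (CommRingCat.ofHom σ)) := by
    rw [HasRingHomProperty.Spec_iff (P := @Flat)]
    change Module.Flat k L
    infer_instance
  have h3 : QuasiCompact (Spec.map (CommRingCat.ofHom σ)) := inferInstance
  exact ⟨⟨MorphismProperty.pullback_fst _ _ h1, MorphismProperty.pullback_fst _ _ h2⟩,
    MorphismProperty.pullback_fst _ _ h3⟩

variable {X₀ Y₀ : SchemeOver k} (f₀ : X₀ ⟶ Y₀)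

/-- **fpqc descent along `Y₀ ⊗_σ L → Y₀`**: a property of morphisms of schemes which descends along
surjective flat quasi-compact morphisms holds for `f₀` as soon as it holds for `f₀ ⊗_σ L`.
[cite: GrothendieckDieudonne1965, Prop. 2.7.1] -/
theorem of_baseChangeHom_map {P : MorphismProperty Scheme}
    [P.DescendsAlong (@Surjective ⊓ @Flat ⊓ @QuasiCompact)]
    (h : P ((baseChangeHom σ).map f₀).left) : P f₀.left := by
  letI := σ.toAlgebra
  exact MorphismProperty.of_isPullback_of_descendsAlong (isPullback_baseChange_map_left L f₀)
    (surjective_flat_quasiCompact_baseChangeHomFst σ Y₀) h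

/-- `f₀` is locally of finite type if `f₀ ⊗_σ L` is. [cite: GrothendieckDieudonne1965, Prop. 2.7.1 (iv)] -/
theorem locallyOfFiniteType_of_baseChangeHom_map
    [LocallyOfFiniteType ((baseChangeHom σ).map f₀).left] : LocallyOfFiniteType f₀.left :=
  of_baseChangeHom_map σ f₀ (P := @LocallyOfFiniteType) ‹_›

/-- `f₀` is smooth if `f₀ ⊗_σ L` is. [cite: EGAIV4, Prop. 17.7.4 (vi)⇒(i)] -/
theorem smooth_of_baseChangeHom_map [Smooth ((baseChangeHom σ).map f₀).left] : Smooth f₀.left :=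
  of_baseChangeHom_map σ f₀ (P := @Smooth) ‹_›

/-- `f₀` is universally closed if `f₀ ⊗_σ L` is. [cite: GrothendieckDieudonne1965, Prop. 2.7.1 (vii)] -/
theorem universallyClosed_of_baseChangeHom_map
    [UniversallyClosed ((baseChangeHom σ).map f₀).left] : UniversallyClosed f₀.left :=
  of_baseChangeHom_map σ f₀ (P := @UniversallyClosed) ‹_›

/-- **Separated = the diagonal is universally closed** (the diagonal of a morphism of schemes is an
immersion, and an immersion with closed image is a closed immersion). [cite: GrothendieckDieudonne1965, Prop. 2.7.1 (i) (proof)] -/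
theorem isSeparated_iff_universallyClosed_diagonal {X Y : Scheme} (f : X ⟶ Y) :
    IsSeparated f ↔ UniversallyClosed (pullback.diagonal f) := by
  refine ⟨fun _ => inferInstance, fun h => ⟨?_⟩⟩
  exact IsClosedImmersion.of_isPreimmersion _ (pullback.diagonal f).isClosedMap.isClosed_range

/-- `f₀` is separated if `f₀ ⊗_σ L` is (the property "diagonal universally closed" descends along
fpqc covers, Mathlib). [cite: GrothendieckDieudonne1965, Prop. 2.7.1 (i)] -/
theorem isSeparated_of_baseChangeHom_map [IsSeparated ((baseChangeHom σ).map f₀).left] :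
    IsSeparated f₀.left := by
  rw [isSeparated_iff_universallyClosed_diagonal, ← MorphismProperty.diagonal_iff (P := @UniversallyClosed)]
  refine of_baseChangeHom_map σ f₀ (P := MorphismProperty.diagonal @UniversallyClosed) ?_
  rw [MorphismProperty.diagonal_iff]
  exact (isSeparated_iff_universallyClosed_diagonal _).1 ‹_›

/-- `f₀` is proper if `f₀ ⊗_σ L` is. [cite: GrothendieckDieudonne1965, Prop. 2.7.1 (vii)] -/
theorem isProper_of_baseChangeHom_map [IsProper ((baseChangeHom σ).map f₀).left] :
    IsProper f₀.left := by
  haveI := isSeparated_of_baseChangeHom_map σ f₀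
  haveI := universallyClosed_of_baseChangeHom_map σ f₀
  haveI := locallyOfFiniteType_of_baseChangeHom_map σ f₀
  exact {}

/-- `Spec L → Spec k` is scheme-theoretically dominant. [folklore] -/
private theorem isSchemeTheoreticallyDominant_specMap_ofHom :
    IsSchemeTheoreticallyDominant (Spec.map (CommRingCat.ofHom σ)) := by
  haveI : Subsingleton ↥(Spec (CommRingCat.of k)) :=
    inferInstanceAs (Subsingleton (PrimeSpectrum k))
  haveI : Surjective (Spec.map (CommRingCat.ofHom σ)) :=
    ⟨fun x ↦ ⟨(default : ↥(Spec (CommRingCat.of L))), Subsingleton.elim _ _⟩⟩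
  haveI : IsReduced (Spec (CommRingCat.of k)) := inferInstance
  exact IsSchemeTheoreticallyDominant.of_isDominant _

/-- **`X₀` is reduced if `X₀ ⊗_σ L` is**: the projection `X₀ ⊗_σ L → X₀` is scheme-theoretically
dominant (a flat base change of `Spec L → Spec k`) and quasi-compact, so it is injective on
sections. [cite: GrothendieckDieudonne1965, Prop. 2.1.13] -/
theorem isReduced_of_baseChangeHom (X₀ : SchemeOver k) [IsReduced ((baseChangeHom σ).obj X₀).left] :
    IsReduced X₀.left := by
  haveI := isSchemeTheoreticallyDominant_specMap_ofHom σ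
  haveI : QuasiCompact (Spec.map (CommRingCat.ofHom σ)) := inferInstance
  haveI : Flat X₀.hom := inferInstance
  haveI : IsSchemeTheoreticallyDominant (baseChangeHomFst σ X₀) :=
    IsSchemeTheoreticallyDominant.pullbackFst _ _
  haveI : QuasiCompact (baseChangeHomFst σ X₀) :=
    (surjective_flat_quasiCompact_baseChangeHomFst σ X₀).2
  exact IsSchemeTheoreticallyDominant.isReduced (baseChangeHomFst σ X₀)

/-- `X₀` is integral if `X₀ ⊗_σ L` is (reduced by the previous result; irreducible as the image
of the surjective projection). [cite: GrothendieckDieudonne1965, Prop. 2.1.13 and Cor. 2.1.14] -/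
theorem isIntegral_of_baseChangeHom (X₀ : SchemeOver k) [IsIntegral ((baseChangeHom σ).obj X₀).left] :
    IsIntegral X₀.left := by
  haveI := isReduced_of_baseChangeHom σ X₀
  haveI : Surjective (baseChangeHomFst σ X₀) := (surjective_flat_quasiCompact_baseChangeHomFst σ X₀).1.1
  have hsurj : Function.Surjective (baseChangeHomFst σ X₀) := (baseChangeHomFst σ X₀).surjective
  haveI : IrreducibleSpace X₀.left := by
    have h : IsIrreducible (Set.univ : Set X₀.left) := by
      rw [← Set.image_univ_of_surjective hsurj]
      exact (IrreducibleSpace.isIrreducible_univ _).image _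
        (baseChangeHomFst σ X₀).continuous.continuousOn
    exact (irreducibleSpace_def _).2 h
  exact isIntegral_of_irreducibleSpace_of_isReduced _

end Descent

end Literature.AlgebraicGeometry.Motives

end
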